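/-
Copyright (c) 2026 the pub-hodgecm-mathlib formalisation cell (harness21).  Prover seat hodgecm-mathlib-B-p04 (g47): LH4-plan (g6) WORD #21 FILE B — the UNIFORM parity core
(memo `MEMO-M4-wild-parity.v1.B-p04g47.md`); 2026-09-02.
-/
import Literature.NumberTheory.Automorphic.SplitTorusOrderLinearSymmetriser   -- ★ FILE A (O8a-∃′, this seat p851619): `exists_criterion_of_linear_norm_solutions`, `map_linearSymm_div_eq_self`, `map_linearSymm_zero∕_one`, `map_nodalDeriv_iota`
import Literature.NumberTheory.Automorphic.SymmetricEigenframeParity          -- ★ [T2-b] kernel (A-p19 (g26) p846537): `log_add_two_mul_log_eq_of_symmetric_frame`, `odd_log_of_map_eq_neg`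
import HarnessLib

/-!
# The good type-(2) class at EVERY residue characteristic: a rational good vector exists iff `½·log|d₀| + n` is even — the UNIFORM parity core with the LINEAR
# symmetriser `ω + σ(ω)·G·X` (Rogawski 1990 Lemma 4.9.3; Jacobowitz 1962 §5, §7; Serre V §2)

Topic `NumberTheory/Automorphic`; namespace `Literature.NumberTheory.Automorphic.SymmetricEigenframe` (= ★ `RationalGoodVectorParity`'s).  THEOREMS ONLY (no definition, no instance,
no notation, no named fact, no `sorry`); generic: ONE field `K` with `[Valued K ℤᵐ⁰]`, a subring `O`, ring endomorphisms `σ`, `ι`.  Cell `pub/hodgecm-mathlib` (D-0151), crux H413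
= `stmt-HodgeConjecture-24833`; half A line LH4, the M4 wall of census F0P3a-p06 (g17) `DUNR-H2-CENSUS`; LH4-plan (g6) WORD #21 FILE B after B-p04 (g47)'s memo
`F0/P3c/LH4/B-p04-g47/MEMO-M4-wild-parity.v1.B-p04g47.md` (FINDING OF RECORD #2, LH4-plan WORD #21).  A SIBLING of ★ `RationalGoodVectorParity.exists_rational_good_iff_even`
(p846562), which is keyed on the TAME tokens `|1 + γᵢ| = 1` (⟺ `|2| = 1`), a skew unit `δ`, `log|γ₁ − γ₂| = −(2N+1)` ODD and the frame parity `Odd(½log|d₀| + log|d₁|)`.  THIS FILE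
drops all four: it takes ONE parity token `hΦL : Even(½log|d₀| + log|d₁| + L)` (`L := log|γ₁ − γ₂|`, any parity) and the seed `ω` of the LINEAR symmetriser (`|ω| ≤ 1`,
`|ω + σω| = 1`, `ιω = ω`), and proves the SAME criterion — valid at the tame row, the wild odd-order row and the wild unit-discriminant row alike (memo §1–§3).  HONEST LABEL:
HC_CM is proved only modulo the 7 printed citations (2 remaining named inputs: hLiu418 = stmt-HodgeConjecture-24832, h413 = stmt-HodgeConjecture-24833) until rung 0 closes;
count-neutral (pays no organ, opens no road — it prices the M4 parity core at every residue characteristic; the wild eigen-field package (D2-β)′ and the EP side (M6) remain).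

THE DICTIONARY (as ★, one-place tokens).  `K` = the ramified quadratic eigen-field `K₁ = L_w(√disc χ_g)`; `σ = σ_w ⊗ 1` (`K ∕ K^σ` UNRAMIFIED); `ι` = the `L_w`-involution (`K ∕ L_w`
RAMIFIED); `O = 𝒪_K` (here `hO : x ∈ O ↔ |x| ≤ 1`); `γ = (u, λ, ιλ)` norm-one eigenvalues in the DEPTH-ZERO regime `|γᵢ − 1| < 1`; `d` the Gram diagonal of the symmetric eigenframe;
`n` with `log|γ₀ − γ₁| = −n`, `L := log|γ₁ − γ₂|` (`= −(2N+1)` tame ∕ wild odd-order, `= −2·ord_w y` wild unit-discriminant); norm dictionaries (nK), (nE), (rE) VERBATIM ★'s.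
THE LINEAR SYMMETRISER (★ FILE A): `G := γ₀γ₁γ₂`, `p(X) := ω + σ(ω)·G·X`, `εᵢ := p(γᵢ)`; `εᵢ ≡ ω + σω (mod 𝔪)` is a UNIT (`hωtr`), `εᵢ ∕ (dᵢVᵢ)` is σ-FIXED (★ `map_linearSymm_div_eq_self`),
`ε₀` is `ι`-fixed and `ιε₁ = ε₂` (★ `map_linearSymm_zero∕_one`, `ιω = ω`, `ι(σω) = σω` from `σι = ισ`).  At the CM place `ω` is any unit of `L_w` with unit trace over `L⁺_v` —
it exists because `v` is inert-UNRAMIFIED; the tame ★ symmetriser is the member `ω = P₀δ²`.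

THE RESULT.  (⟸, §2) From `Even(½log|d₀| + n)`: `log|d₀V₀∕ε₀| = log|d₀| − 2n ∈ 4ℤ` (`hd0`) feeds (nE) ⇒ rational `a₀` with `a₀σ(a₀)·d₀V₀ = ε₀`; `log|d₁V₁∕ε₁| = log|d₁| − n + L`
is EVEN by `hΦL` ⇒ (nK) gives `a₁`; `a₂ := ιa₁` solves the third equation; ★ FILE A `exists_criterion_of_linear_norm_solutions` makes `a` GOOD.  (⟹, §3) a rational GOOD `a` has
`T₀ = d₀a₀σ(a₀)V₀ ∈ O^×`, so `log|d₀| − 2n = −2log|a₀| ∈ 4ℤ` by (rE) — no symmetriser at all.  (§4) **`exists_rational_good_iff_even_uniform`**.  (§5) the FRAME-PARITY SUPPLIERS: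
`½log|d₀| + log|d₁| = log|det M|` for a symmetric eigenframe with unimodular Gram matrix (★ kernel), so `hΦL = Even(log|det M| + L)`: at the tame ∕ wild-odd rows `log|det M|` and `L`
are both ODD (★ `odd_log_of_map_eq_neg`, anti-fixed uniformiser), at the wild unit-discriminant row both are EVEN (★ `WildQuadraticEisensteinFrame.even_log_of_map_eq_neg_of_skew_sq`,
`|γ₁ − γ₂| = |y·α|`, `α` a unit) — THE TWO WILD PARITY FLIPS CANCEL (memo §1).  HONESTY: uniform in the residue characteristic; at `|2| = 1` with a `ω := P₀δ²`-type seed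
it re-proves ★ `exists_rational_good_iff_even`; CONSUMER-FREE today (the wild eigen-field package (D2-β)′ is not typed); memo `MEMO-M4-wild-parity.v1.B-p04g47.md` sha16 4adf46b309de30b6.

## References
* [Rogawski1990] J. D. Rogawski, *Automorphic Representations of Unitary Groups in Three Variables* (1990), §4.9 Lemma 4.9.3 p. 56, Prop. 4.9.1 (b) p. 55.
* [Jacobowitz1962] R. Jacobowitz, *Hermitian forms over local fields*, Amer. J. Math. 84 (1962), §4, §5, §7 Thm. 7.1, §§9–11 (ramified dyadic).
* [SerreLocalFields1979] J.-P. Serre, *Local Fields*, GTM 67 (1979), Ch. V §2 Prop. 3 (norms at an unramified extension), Ch. I §6 (ramified quadratic).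
-/

set_option autoImplicit false

noncomputable section

open Finset
open scoped WithZero Matrix

namespace Literature.NumberTheory.Automorphic.SymmetricEigenframe

open Literature.NumberTheory.Automorphic

variable {K : Type*} [Field K] [Valued K ℤᵐ⁰]

/-! ## §1 Depth-zero nodes and the values `εᵢ = ω + σ(ω)·G·γᵢ` of the linear symmetriser -/

/-- In the depth-zero regime `|γᵢ − 1| < 1` every node is a unit: `|γᵢ| = 1`. [cite: Jacobowitz1962, §5] -/
theorem v_eq_one_of_v_sub_one_lt {γ : K} (h : Valued.v (γ - 1) < 1) : Valued.v γ = 1 := by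
  have := Valuation.map_add_eq_of_lt_left Valued.v (x := (1 : K)) (y := γ - 1) (by rw [Valuation.map_one]; exact h)
  rwa [add_sub_cancel, Valuation.map_one] at this

/-- `|γ₀γ₁γ₂·γᵢ − 1| < 1` in the depth-zero regime. [cite: Jacobowitz1962, §5] -/
theorem v_prod_mul_sub_one_lt {γ : Fin 3 → K} (hγ1 : ∀ i, Valued.v (γ i - 1) < 1) (i : Fin 3) :
    Valued.v (γ 0 * γ 1 * γ 2 * γ i - 1) < 1 := by
  have hu : ∀ j, Valued.v (γ j) = 1 := fun j => v_eq_one_of_v_sub_one_lt (hγ1 j)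
  have key : γ 0 * γ 1 * γ 2 * γ i - 1 = (γ 0 - 1) * (γ 1 * γ 2 * γ i) + ((γ 1 - 1) * (γ 2 * γ i) + ((γ 2 - 1) * γ i + (γ i - 1))) := by ring
  rw [key]
  refine Valuation.map_add_lt _ ?_ (Valuation.map_add_lt _ ?_ (Valuation.map_add_lt _ ?_ (hγ1 i)))
  · rw [map_mul, map_mul, map_mul, hu, hu, hu, mul_one, mul_one, mul_one]; exact hγ1 0
  · rw [map_mul, map_mul, hu, hu, mul_one, mul_one]; exact hγ1 1
  · rw [map_mul, hu, mul_one]; exact hγ1 2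

/-- **THE VALUES OF THE LINEAR SYMMETRISER ARE UNITS**: `|ω + σ(ω)·G·γᵢ| = 1` when `|ω| ≤ 1`, `|σ| = |·|`, `|ω + σω| = 1` and the nodes are in the depth-zero regime
(`εᵢ − (ω + σω) = σω·(Gγᵢ − 1) ∈ 𝔪`). [cite: Jacobowitz1962, §5] [cite: SerreLocalFields1979, Ch. V §2 Prop. 3] -/
theorem v_linearSymm_eq_one (σ : K →+* K) (hσv : ∀ x, Valued.v (σ x) = Valued.v x) {γ : Fin 3 → K} (hγ1 : ∀ i, Valued.v (γ i - 1) < 1)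
    {ω : K} (hω : Valued.v ω ≤ 1) (hωtr : Valued.v (ω + σ ω) = 1) (i : Fin 3) :
    Valued.v (ω + σ ω * (γ 0 * γ 1 * γ 2) * γ i) = 1 := by
  have key : ω + σ ω * (γ 0 * γ 1 * γ 2) * γ i = (ω + σ ω) + σ ω * (γ 0 * γ 1 * γ 2 * γ i - 1) := by ring
  rw [key, ← hωtr]
  refine Valuation.map_add_eq_of_lt_left _ ?_
  rw [hωtr, map_mul, hσv]
  exact (mul_le_of_le_one_left' hω).trans_lt (v_prod_mul_sub_one_lt hγ1 i)

/-! ## §2 (⟸) A rational good vector from the parity — uniform -/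

/-- **(⟸) UNIFORM: A RATIONAL GOOD VECTOR EXISTS ON THE PARITY CLASS, AT EVERY RESIDUE CHARACTERISTIC.**  In the dictionary of the module docstring, with the linear symmetriser's
seed `ω` (`|ω| ≤ 1`, `|ω + σω| = 1`, `ιω = ω`) in place of ★'s `δ` and Cayley units, `L = log|γ₁ − γ₂|` of any parity and ONE parity token `hΦL : Even(½log|d₀| + log|d₁| + L)`:
if `½·log|d₀| + n` is even then there is a RATIONAL GOOD `a` (`ι a₀ = a₀`, `a₂ = ι a₁`, ★ O8a's GOOD token).  The norm equations `aᵢσ(aᵢ)·dᵢVᵢ = εᵢ := ω + σ(ω)·G·γᵢ` have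
σ-fixed right-hand sides (★ FILE A `map_linearSymm_div_eq_self`); `log|d₀V₀∕ε₀| = log|d₀| − 2n ∈ 4ℤ` feeds (nE), `log|d₁V₁∕ε₁| = log|d₁| − n + L ∈ 2ℤ` (by `hΦL`, `hd0`, `heven`)
feeds (nK), `a₂ := ιa₁`; then ★ FILE A `exists_criterion_of_linear_norm_solutions`. [cite: Rogawski1990, §4.9 Lemma 4.9.3 p. 56] [cite: Jacobowitz1962, §5, §7 Thm. 7.1]
[cite: SerreLocalFields1979, Ch. V §2 Prop. 3] -/
theorem exists_rational_good_of_even_uniform (O : Subring K) (hO : ∀ x : K, x ∈ O ↔ Valued.v x ≤ 1) (σ ι : K →+* K)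
    (hσσ : ∀ x, σ (σ x) = x) (hσι : ∀ x, σ (ι x) = ι (σ x)) (hσv : ∀ x, Valued.v (σ x) = Valued.v x) (hιv : ∀ x, Valued.v (ι x) = Valued.v x)
    (hnK : ∀ c : K, c ≠ 0 → σ c = c → Even (WithZero.log (Valued.v c)) → ∃ a : K, a * σ a * c = 1)
    (hnE : ∀ c : K, c ≠ 0 → σ c = c → ι c = c → (4 : ℤ) ∣ WithZero.log (Valued.v c) → ∃ a : K, ι a = a ∧ a * σ a * c = 1)
    {γ d : Fin 3 → K} (hγ1 : ∀ i, Valued.v (γ i - 1) < 1) (hσγ : ∀ i, σ (γ i) = (γ i)⁻¹) (hinj : Function.Injective γ)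
    (hιγ0 : ι (γ 0) = γ 0) (hιγ1 : ι (γ 1) = γ 2) (hιγ2 : ι (γ 2) = γ 1)
    (hdσ : ∀ i, σ (d i) = d i) (hdne : ∀ i, d i ≠ 0) (hιd0 : ι (d 0) = d 0) (hιd1 : ι (d 1) = d 2)
    {ω : K} (hω : Valued.v ω ≤ 1) (hωtr : Valued.v (ω + σ ω) = 1) (hιω : ι ω = ω)
    {n : ℕ} {L : ℤ} (h01 : WithZero.log (Valued.v (γ 0 - γ 1)) = -(n : ℤ)) (h12 : WithZero.log (Valued.v (γ 1 - γ 2)) = L)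
    (hd0 : Even (WithZero.log (Valued.v (d 0)))) (hΦL : Even (WithZero.log (Valued.v (d 0)) / 2 + WithZero.log (Valued.v (d 1)) + L))
    (heven : Even (WithZero.log (Valued.v (d 0)) / 2 + n)) :
    ∃ a : Fin 3 → K, ι (a 0) = a 0 ∧ a 2 = ι (a 1) ∧
      ((fun i => d i * a i * σ (a i) * ∏ j ∈ univ.erase i, (γ i - γ j)) ∈ Submodule.span O (Set.range fun j : Fin 3 => fun i => γ i ^ (j : ℕ)) ∧
        ∀ i, ∃ y ∈ O, y * (d i * a i * σ (a i) * ∏ j ∈ univ.erase i, (γ i - γ j)) = 1) := by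
  -- nodes: units, in `O`, non-zero
  have hvγ : ∀ i, Valued.v (γ i) = 1 := fun i => v_eq_one_of_v_sub_one_lt (hγ1 i)
  have hγne : ∀ i, γ i ≠ 0 := fun i h0 => by have := hvγ i; rw [h0, map_zero] at this; exact zero_ne_one this
  have hγO : ∀ i, γ i ∈ O := fun i => (hO _).2 (hvγ i).le
  -- the symmetriser data
  set G : K := γ 0 * γ 1 * γ 2 with hGdef
  set c₁ : K := σ ω * G with hc₁def
  set ε : Fin 3 → K := fun i => ω + c₁ * γ i with hεdef
  set V : Fin 3 → K := fun i => ∏ j ∈ univ.erase i, (γ i - γ j) with hVdef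
  have hωO : ω ∈ O := (hO ω).2 hω
  have hc₁O : c₁ ∈ O := (hO c₁).2 (by
    rw [hc₁def, map_mul, hσv, hGdef, map_mul, map_mul, hvγ, hvγ, hvγ, mul_one, mul_one, mul_one]; exact hω)
  have hvε : ∀ i, Valued.v (ε i) = 1 := fun i => by
    simp only [hεdef, hc₁def, hGdef]; exact v_linearSymm_eq_one σ hσv hγ1 hω hωtr i
  have hεne : ∀ i, ε i ≠ 0 := fun i h0 => by have := hvε i; rw [h0, map_zero] at this; exact zero_ne_one this
  have hεu : ∀ i, ∃ y ∈ O, y * (ω + c₁ * γ i) = 1 := fun i =>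
    ⟨(ε i)⁻¹, (hO _).2 (by rw [map_inv₀, hvε, inv_one]), by simp only [hεdef] at hεne ⊢; exact inv_mul_cancel₀ (hεne i)⟩
  -- differences of eigenvalues
  have h01ne : γ 0 - γ 1 ≠ 0 := sub_ne_zero.2 fun h => by have := hinj h; exact absurd this (by decide)
  have h02ne : γ 0 - γ 2 ≠ 0 := sub_ne_zero.2 fun h => by have := hinj h; exact absurd this (by decide)
  have h12ne : γ 1 - γ 2 ≠ 0 := sub_ne_zero.2 fun h => by have := hinj h; exact absurd this (by decide)
  have h10ne : γ 1 - γ 0 ≠ 0 := fun h => h01ne (by rw [← neg_sub, h, neg_zero])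
  have h02 : WithZero.log (Valued.v (γ 0 - γ 2)) = -(n : ℤ) := by
    rw [← h01, show γ 0 - γ 2 = ι (γ 0 - γ 1) by rw [map_sub, hιγ0, hιγ1], hιv]
  have h10 : WithZero.log (Valued.v (γ 1 - γ 0)) = -(n : ℤ) := by rw [← neg_sub, Valuation.map_neg, h01]
  have hVne : ∀ i, V i ≠ 0 := fun i =>
    Finset.prod_ne_zero_iff.2 fun j hj => sub_ne_zero.2 fun h => (Finset.ne_of_mem_erase hj) (hinj h).symm
  have hV0log : WithZero.log (Valued.v (V 0)) = -(n : ℤ) + -(n : ℤ) := by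
    simp only [hVdef]
    rw [show univ.erase (0 : Fin 3) = {1, 2} by decide, Finset.prod_pair (by decide), map_mul,
      WithZero.log_mul ((Valuation.ne_zero_iff _).2 h01ne) ((Valuation.ne_zero_iff _).2 h02ne), h01, h02]
  have hV1log : WithZero.log (Valued.v (V 1)) = -(n : ℤ) + L := by
    simp only [hVdef]
    rw [show univ.erase (1 : Fin 3) = {0, 2} by decide, Finset.prod_pair (by decide), map_mul,
      WithZero.log_mul ((Valuation.ne_zero_iff _).2 h10ne) ((Valuation.ne_zero_iff _).2 h12ne), h10, h12]
  -- the norm-equation constants `cᵢ' := dᵢVᵢ ∕ εᵢ`: σ-fixed, `c₀'` `ι`-fixed, `ι c₁' = c₂'`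
  set c : Fin 3 → K := fun i => d i * V i / ε i with hcdef
  have hcne : ∀ i, c i ≠ 0 := fun i => div_ne_zero (mul_ne_zero (hdne i) (hVne i)) (hεne i)
  have hcσ : ∀ i, σ (c i) = c i := by
    intro i
    have h := map_linearSymm_div_eq_self σ hσσ hσγ hγne hinj hdσ ω i
    -- `σ (ε∕(dV)) = ε∕(dV)` ⇒ `σ (dV∕ε) = dV∕ε`
    have h' : σ ((ε i) / (d i * V i)) = ε i / (d i * V i) := by simp only [hεdef, hc₁def, hGdef, hVdef]; exact h
    simp only [hcdef]
    rw [← inv_div, map_inv₀, h', inv_div]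
  have hισω : ι (σ ω) = σ ω := by rw [← hσι, hιω]
  have hιε0 : ι (ε 0) = ε 0 := by
    simp only [hεdef, hc₁def, hGdef]; exact map_linearSymm_zero ι hιγ0 hιγ1 hιγ2 hιω hισω
  have hιε1 : ι (ε 1) = ε 2 := by
    simp only [hεdef, hc₁def, hGdef]; exact map_linearSymm_one ι hιγ0 hιγ1 hιγ2 hιω hισω
  obtain ⟨hιV0, hιV1⟩ := map_nodalDeriv_iota ι (γ := γ) hιγ0 hιγ1 hιγ2
  have hιc0 : ι (c 0) = c 0 := by
    simp only [hcdef]; rw [map_div₀, map_mul, hιd0, hιε0]; simp only [hVdef]; rw [hιV0]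
  have hιc1 : ι (c 1) = c 2 := by
    simp only [hcdef]; rw [map_div₀, map_mul, hιd1, hιε1]; simp only [hVdef]; rw [hιV1]
  -- exponents and parities
  have hc0log : WithZero.log (Valued.v (c 0)) = WithZero.log (Valued.v (d 0)) - 2 * n := by
    simp only [hcdef]
    rw [map_div₀, map_mul, WithZero.log_div (mul_ne_zero ((Valuation.ne_zero_iff _).2 (hdne 0)) ((Valuation.ne_zero_iff _).2 (hVne 0)))
      ((Valuation.ne_zero_iff _).2 (hεne 0)), WithZero.log_mul ((Valuation.ne_zero_iff _).2 (hdne 0)) ((Valuation.ne_zero_iff _).2 (hVne 0)), hV0log, hvε,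
      WithZero.log_one]
    ring
  have hc1log : WithZero.log (Valued.v (c 1)) = WithZero.log (Valued.v (d 1)) - n + L := by
    simp only [hcdef]
    rw [map_div₀, map_mul, WithZero.log_div (mul_ne_zero ((Valuation.ne_zero_iff _).2 (hdne 1)) ((Valuation.ne_zero_iff _).2 (hVne 1)))
      ((Valuation.ne_zero_iff _).2 (hεne 1)), WithZero.log_mul ((Valuation.ne_zero_iff _).2 (hdne 1)) ((Valuation.ne_zero_iff _).2 (hVne 1)), hV1log, hvε,
      WithZero.log_one]
    ring
  obtain ⟨k0, hk0⟩ := hd0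
  obtain ⟨m, hm⟩ := heven
  obtain ⟨m', hm'⟩ := hΦL
  have h4 : (4 : ℤ) ∣ WithZero.log (Valued.v (c 0)) := by
    rw [hc0log]; exact ⟨m - n, by omega⟩
  have heven1 : Even (WithZero.log (Valued.v (c 1))) := by
    rw [hc1log]; exact ⟨m' - m, by omega⟩
  -- the norm solutions
  obtain ⟨a0, ha0ι, ha0⟩ := hnE (c 0) (hcne 0) (hcσ 0) hιc0 h4
  obtain ⟨a1, ha1⟩ := hnK (c 1) (hcne 1) (hcσ 1) heven1
  have ha2 : ι a1 * σ (ι a1) * c 2 = 1 := by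
    rw [hσι, ← hιc1, ← map_mul, ← map_mul, ha1, map_one]
  -- `aᵢσ(aᵢ)·(dᵢVᵢ) = εᵢ`
  have hsol : ∀ {x : K} {i : Fin 3}, x * σ x * c i = 1 → x * σ x * (d i * V i) = ω + c₁ * γ i := by
    intro x i hx
    have hε := hεne i
    have hx' : x * σ x * (d i * V i) = ε i := by
      simp only [hcdef] at hx
      rw [← mul_div_assoc, div_eq_one_iff_eq hε] at hx
      exact hx
    simpa only [hεdef] using hx'
  refine ⟨![a0, a1, ι a1], ha0ι, rfl, ?_⟩
  have ha : ∀ i, (![a0, a1, ι a1] : Fin 3 → K) i * σ ((![a0, a1, ι a1] : Fin 3 → K) i) * (d i * ∏ j ∈ univ.erase i, (γ i - γ j)) = ω + c₁ * γ i := by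
    intro i
    fin_cases i
    · exact hsol ha0
    · exact hsol ha1
    · exact hsol ha2
  exact exists_criterion_of_linear_norm_solutions O σ hγO hωO hc₁O d _ ha hεu

/-! ## §3 (⟹) The parity from a rational good vector — no symmetriser -/

/-- **(⟹) UNIFORM: A RATIONAL GOOD VECTOR FORCES THE PARITY** at every residue characteristic: `T₀ = d₀a₀σ(a₀)V₀` is a unit of `O` (the GOOD token itself), so
`log|d₀| − 2n = −2·log|a₀| ∈ 4ℤ` by (rE).  No `1 + γᵢ`, no `δ`, no `ω`. [cite: Rogawski1990, §4.9 Lemma 4.9.3 p. 56] [cite: Jacobowitz1962, §5] -/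
theorem even_of_rational_good_uniform (O : Subring K) (σ ι : K →+* K) (hO : ∀ x ∈ O, Valued.v x ≤ 1)
    (hσv : ∀ x, Valued.v (σ x) = Valued.v x) (hrE : ∀ x : K, x ≠ 0 → ι x = x → Even (WithZero.log (Valued.v x)))
    {γ d : Fin 3 → K} (hγO : ∀ i, γ i ∈ O) (hinj : Function.Injective γ) (hιγ0 : ι (γ 0) = γ 0) (hιγ1 : ι (γ 1) = γ 2)
    (hιv : ∀ x, Valued.v (ι x) = Valued.v x) (hdne : ∀ i, d i ≠ 0)
    {n : ℕ} (h01 : WithZero.log (Valued.v (γ 0 - γ 1)) = -(n : ℤ))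
    {a : Fin 3 → K} (ha0 : ι (a 0) = a 0)
    (hgood : ((fun i => d i * a i * σ (a i) * ∏ j ∈ univ.erase i, (γ i - γ j)) ∈ Submodule.span O (Set.range fun j : Fin 3 => fun i => γ i ^ (j : ℕ)) ∧
        ∀ i, ∃ y ∈ O, y * (d i * a i * σ (a i) * ∏ j ∈ univ.erase i, (γ i - γ j)) = 1)) :
    Even (WithZero.log (Valued.v (d 0)) / 2 + n) := by
  have h01ne : γ 0 - γ 1 ≠ 0 := sub_ne_zero.2 fun h => by have := hinj h; exact absurd this (by decide)
  have h02ne : γ 0 - γ 2 ≠ 0 := sub_ne_zero.2 fun h => by have := hinj h; exact absurd this (by decide)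
  have h02 : WithZero.log (Valued.v (γ 0 - γ 2)) = -(n : ℤ) := by
    rw [← h01, show γ 0 - γ 2 = ι (γ 0 - γ 1) by rw [map_sub, hιγ0, hιγ1], hιv]
  obtain ⟨hT0O, y, hyO, hy⟩ := criterion_apply_mem_and_unit_of_good O σ hγO d a hgood 0
  set x : K := d 0 * a 0 * σ (a 0) * ∏ j ∈ univ.erase (0 : Fin 3), (γ 0 - γ j) with hx
  -- `x ∈ O`, `y ∈ O`, `y x = 1` ⇒ `|x| = 1`
  have hvx : Valued.v x = 1 := by
    apply le_antisymm (hO x hT0O)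
    have h1 : Valued.v y * Valued.v x = 1 := by rw [← map_mul, hy, map_one]
    by_contra hlt
    rw [not_le] at hlt
    have : Valued.v y * Valued.v x < 1 := by
      calc Valued.v y * Valued.v x ≤ 1 * Valued.v x := by gcongr; exact hO y hyO
        _ < 1 := by rw [one_mul]; exact hlt
    rw [h1] at this
    exact lt_irrefl _ this
  have ha0ne : a 0 ≠ 0 := fun h0 => by rw [hx, h0, mul_zero, zero_mul, zero_mul, map_zero] at hvx; exact zero_ne_one hvx
  have hva : Valued.v (a 0) ≠ 0 := (Valuation.ne_zero_iff _).2 ha0ne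
  have hvd : Valued.v (d 0) ≠ 0 := (Valuation.ne_zero_iff _).2 (hdne 0)
  have hV : Valued.v (∏ j ∈ univ.erase (0 : Fin 3), (γ 0 - γ j)) = Valued.v (γ 0 - γ 1) * Valued.v (γ 0 - γ 2) := by
    rw [show univ.erase (0 : Fin 3) = {1, 2} by decide, Finset.prod_pair (by decide), map_mul]
  have hv01 : Valued.v (γ 0 - γ 1) ≠ 0 := (Valuation.ne_zero_iff _).2 h01ne
  have hv02 : Valued.v (γ 0 - γ 2) ≠ 0 := (Valuation.ne_zero_iff _).2 h02ne
  have hlog := congrArg WithZero.log hvx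
  rw [hx, map_mul, map_mul, map_mul, hσv, hV, WithZero.log_one,
    WithZero.log_mul (mul_ne_zero (mul_ne_zero hvd hva) hva) (mul_ne_zero hv01 hv02), WithZero.log_mul (mul_ne_zero hvd hva) hva,
    WithZero.log_mul hvd hva, WithZero.log_mul hv01 hv02, h01, h02] at hlog
  obtain ⟨k, hk⟩ := hrE (a 0) ha0ne ha0
  exact ⟨n - k, by omega⟩

/-! ## §4 The uniform equivalence -/

/-- **[T2-b] UNIFORM CORE — «THE GOOD CLASS IS THE ONE WITH `κ = (−1)^n`» AT EVERY RESIDUE CHARACTERISTIC.**  For a symmetric type-(2) eigen-datum `(γ, d)` in the depth-zero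
regime over the ramified eigen-field `K` with its involutions `σ` (CM, `K∕K^σ` unramified), `ι` (rationality), the norm dictionaries (nK), (nE), (rE), a linear-symmetriser seed `ω`
(`|ω| ≤ 1`, `|ω + σω| = 1`, `ιω = ω`), `L = log|γ₁ − γ₂|` and the single parity token `Even(½log|d₀| + log|d₁| + L)`: a RATIONAL GOOD vector exists **iff** `½·log|d₀| + n` is even.
This is ★ `exists_rational_good_iff_even` with the tame tokens (`|1 + γᵢ| = 1`, `δ`, `L` odd, frame parity odd) REMOVED — the criterion is ROW-INDEPENDENT (tame ∕ wild odd-order ∕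
wild unit-discriminant; memo FINDING #2). [cite: Rogawski1990, §4.9 Lemma 4.9.3 p. 56, Prop. 4.9.1 (b) p. 55] [cite: Jacobowitz1962, §5, §7 Thm. 7.1, §§9–11]
[cite: SerreLocalFields1979, Ch. V §2 Prop. 3] -/
theorem exists_rational_good_iff_even_uniform (O : Subring K) (hO : ∀ x : K, x ∈ O ↔ Valued.v x ≤ 1) (σ ι : K →+* K)
    (hσσ : ∀ x, σ (σ x) = x) (hσι : ∀ x, σ (ι x) = ι (σ x)) (hσv : ∀ x, Valued.v (σ x) = Valued.v x) (hιv : ∀ x, Valued.v (ι x) = Valued.v x)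
    (hnK : ∀ c : K, c ≠ 0 → σ c = c → Even (WithZero.log (Valued.v c)) → ∃ a : K, a * σ a * c = 1)
    (hnE : ∀ c : K, c ≠ 0 → σ c = c → ι c = c → (4 : ℤ) ∣ WithZero.log (Valued.v c) → ∃ a : K, ι a = a ∧ a * σ a * c = 1)
    (hrE : ∀ x : K, x ≠ 0 → ι x = x → Even (WithZero.log (Valued.v x)))
    {γ d : Fin 3 → K} (hγ1 : ∀ i, Valued.v (γ i - 1) < 1) (hσγ : ∀ i, σ (γ i) = (γ i)⁻¹) (hinj : Function.Injective γ)
    (hιγ0 : ι (γ 0) = γ 0) (hιγ1 : ι (γ 1) = γ 2) (hιγ2 : ι (γ 2) = γ 1)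
    (hdσ : ∀ i, σ (d i) = d i) (hdne : ∀ i, d i ≠ 0) (hιd0 : ι (d 0) = d 0) (hιd1 : ι (d 1) = d 2)
    {ω : K} (hω : Valued.v ω ≤ 1) (hωtr : Valued.v (ω + σ ω) = 1) (hιω : ι ω = ω)
    {n : ℕ} {L : ℤ} (h01 : WithZero.log (Valued.v (γ 0 - γ 1)) = -(n : ℤ)) (h12 : WithZero.log (Valued.v (γ 1 - γ 2)) = L)
    (hd0 : Even (WithZero.log (Valued.v (d 0)))) (hΦL : Even (WithZero.log (Valued.v (d 0)) / 2 + WithZero.log (Valued.v (d 1)) + L)) :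
    (∃ a : Fin 3 → K, ι (a 0) = a 0 ∧ a 2 = ι (a 1) ∧
      ((fun i => d i * a i * σ (a i) * ∏ j ∈ univ.erase i, (γ i - γ j)) ∈ Submodule.span O (Set.range fun j : Fin 3 => fun i => γ i ^ (j : ℕ)) ∧
        ∀ i, ∃ y ∈ O, y * (d i * a i * σ (a i) * ∏ j ∈ univ.erase i, (γ i - γ j)) = 1)) ↔
      Even (WithZero.log (Valued.v (d 0)) / 2 + n) := by
  have hγO : ∀ i, γ i ∈ O := fun i => (hO _).2 (v_eq_one_of_v_sub_one_lt (hγ1 i)).le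
  constructor
  · rintro ⟨a, ha0, -, hgood⟩
    exact even_of_rational_good_uniform O σ ι (fun x hx => (hO x).1 hx) hσv hrE hγO hinj hιγ0 hιγ1 hιv hdne h01 ha0 hgood
  · exact exists_rational_good_of_even_uniform O hO σ ι hσσ hσι hσv hιv hnK hnE hγ1 hσγ hinj hιγ0 hιγ1 hιγ2 hdσ hdne hιd0 hιd1 hω hωtr hιω h01 h12 hd0 hΦL

/-! ## §5 The frame-parity suppliers: `½log|d₀| + log|d₁| = log|det M|` (unimodular Gram), so `hΦL = Even(log|det M| + L)` -/

/-- **`½·log|d₀| + log|d₁| = log|det M|`** for a symmetric eigenframe `M` with Gram matrix `ᵗ(σM)·H·M = diag(d)`, `|d₂| = |d₁|`, `|det H| = 1` (★ kernel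
`log_add_two_mul_log_eq_of_symmetric_frame`); and `log|d₀|` is even. [cite: Rogawski1990, §4.9 Lemma 4.9.3 p. 56] [cite: Jacobowitz1962, §7 Thm. 7.1] -/
theorem half_log_add_log_eq_log_det_of_symmetric_frame (σ : K →+* K) (hσv : ∀ x, Valued.v (σ x) = Valued.v x)
    (H M : Matrix (Fin 3) (Fin 3) K) (d : Fin 3 → K) (hG : (M.map σ)ᵀ * H * M = Matrix.diagonal d)
    (hd0 : d 0 ≠ 0) (hd1 : d 1 ≠ 0) (hd12 : Valued.v (d 2) = Valued.v (d 1)) (hM : M.det ≠ 0) (hH : Valued.v H.det = 1) :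
    Even (WithZero.log (Valued.v (d 0))) ∧ WithZero.log (Valued.v (d 0)) / 2 + WithZero.log (Valued.v (d 1)) = WithZero.log (Valued.v M.det) := by
  have hH0 : H.det ≠ 0 := fun h0 => by rw [h0, map_zero] at hH; exact zero_ne_one hH
  have h := log_add_two_mul_log_eq_of_symmetric_frame σ hσv H M d hG hd0 hd1 hd12 hM hH0
  rw [hH, WithZero.log_one, add_zero] at h
  refine ⟨⟨WithZero.log (Valued.v M.det) - WithZero.log (Valued.v (d 1)), by omega⟩, by omega⟩

/-- **WILD UNIT-DISCRIMINANT ROW: the frame parity is EVEN** when `det M` has even `log`-valuation (★ `WildQuadraticEisensteinFrame.even_log_of_map_eq_neg_of_skew_sq` ∘ ★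
`map_det_eq_neg_det_of_cols`: `ι det M = −det M`, skew ⇒ even in the unit-discriminant frame) — the twin of ★ `odd_half_log_add_log_of_symmetric_frame`.
[cite: Rogawski1990, §4.9 Lemma 4.9.3 p. 56] [cite: Jacobowitz1962, §§9–11] -/
theorem even_half_log_add_log_of_symmetric_frame (σ : K →+* K) (hσv : ∀ x, Valued.v (σ x) = Valued.v x)
    (H M : Matrix (Fin 3) (Fin 3) K) (d : Fin 3 → K) (hG : (M.map σ)ᵀ * H * M = Matrix.diagonal d)
    (hd0 : d 0 ≠ 0) (hd1 : d 1 ≠ 0) (hd12 : Valued.v (d 2) = Valued.v (d 1)) (hM0 : M.det ≠ 0) (hH : Valued.v H.det = 1)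
    (hM : Even (WithZero.log (Valued.v M.det))) :
    Even (WithZero.log (Valued.v (d 0))) ∧ Even (WithZero.log (Valued.v (d 0)) / 2 + WithZero.log (Valued.v (d 1))) := by
  obtain ⟨hev, h⟩ := half_log_add_log_eq_log_det_of_symmetric_frame σ hσv H M d hG hd0 hd1 hd12 hM0 hH
  exact ⟨hev, h ▸ hM⟩

/-- **THE PARITY TOKEN `hΦL` FROM THE FRAME**: `Even(½log|d₀| + log|d₁| + L) ⟺ Even(log|det M| + L)` — so it holds when `log|det M|` and `L = log|γ₁ − γ₂|` have the SAME parity: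
both odd at the tame and wild odd-order rows (★ `odd_log_of_map_eq_neg`), both even at the wild unit-discriminant row (★ (Π6)).  [cite: Rogawski1990, §4.9 Lemma 4.9.3 p. 56]
[cite: Jacobowitz1962, §5, §§9–11] -/
theorem even_half_log_add_log_add_of_symmetric_frame (σ : K →+* K) (hσv : ∀ x, Valued.v (σ x) = Valued.v x)
    (H M : Matrix (Fin 3) (Fin 3) K) (d : Fin 3 → K) (hG : (M.map σ)ᵀ * H * M = Matrix.diagonal d)
    (hd0 : d 0 ≠ 0) (hd1 : d 1 ≠ 0) (hd12 : Valued.v (d 2) = Valued.v (d 1)) (hM0 : M.det ≠ 0) (hH : Valued.v H.det = 1)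
    {L : ℤ} (hML : Even (WithZero.log (Valued.v M.det) + L)) :
    Even (WithZero.log (Valued.v (d 0))) ∧ Even (WithZero.log (Valued.v (d 0)) / 2 + WithZero.log (Valued.v (d 1)) + L) := by
  obtain ⟨hev, h⟩ := half_log_add_log_eq_log_det_of_symmetric_frame σ hσv H M d hG hd0 hd1 hd12 hM0 hH
  exact ⟨hev, h ▸ hML⟩

end Literature.NumberTheory.Automorphic.SymmetricEigenframe

end
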